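import Summits.HubbardSuperconductivity.HubbardLadder.Bounds.ThermalHoleDoublonKineticCeiling
import HarnessLib

/-!
# Hubbard ladder — Bounds: strong-coupling (Mott-proximity) STIFFNESS ceilings at `T > 0`, `t–t'`
# class — `ρ_s(T) ≤ (|t| + 2|t'|)·n_h + O(t²/U) + O(T/U)` with ONE entropy term
# (bounds.tex Thm 7_T(xii)–(xiv); part 2 of 2 — part 1 = `ThermalHoleDoublonKineticCeiling.lean`)

HONEST FRAMING (cell pub-hubbard): ladder R1–R4 with certified numbers; no claim on H/H₀. These are
bounds for a MODEL CLASS — the `t–t'` Hubbard torus `hubbardTorusTT' L 1 t' U` on `(ℤ/Lℤ)²`, `L ≥ 3`,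
every real `t'`, every filling at or below half filling (`δ ≥ 0`), `U > 8(1 + |t'|)`, in the
canonical `(N_L, S^z = 0)` Gibbs state at `β > 0`, for a stiffness DEFINED from the flux response of
the sector free energy — and no materials claim. Companion text: `pub-hubbard/paper/bounds.tex` §7
(Theorem 7_T); tables `pub-hubbard/pub-hubbard-bounds/BOUNDS.md` (row T5_T), `EXTREMISERS.md` §5p.

The thermal `x`-seam f-sum floor `ρ_s L² ≤ ½ Re⟨K_{t'}|_p⟩_{β,p}`
(`thermalStiffnessTT'_mul_sq_le_kinetic`) and rotation averaging (`two_mul_re_gibbsState_kinOpTT'_le`)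
give `ρ_s L² ≤ -¼ Re⟨H^{t,2t'}(0)|_p⟩_{β,p}`, and part 1's thermal hole–doublon kinetic ceiling
(`neg_re_gibbsState_hoppingTwo_le_holeDoublon`) bounds the right side. At `T → 0` the statements are
the landed Thm 7(vii)–(x) (`StrongCouplingStiffnessCeilingTPrime.lean`); at `T > 0` they carry ONE
entropy term `T (log N_p)/L² ≤ T log 4` inside the `1/(U - U₁)` chord (cf. the half-filled
`ThermalMottStiffnessCeiling.lean`, Thm 7♯_T, which this file extends to every filling `δ ≥ 0`).

## What is proved (no `sorry`, no new axioms; `τ := 1 + |t'|`, `τ₂ := 1 + 2|t'|`,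
## `n_h = holeDensity L δ = (L² - N_L)/L²`, `N_L = 2⌊(1-δ)L²/2⌋`, `N_p := dim p`, `c := 2 + 2ω⁻¹`)

* `log_card_sector_le` — the universal entropy budget `log N_p ≤ L² log 4` of a coordinate sector.
* `thermalStiffness_mul_sq_le_holeDoublon` — **Thm 7_T(xii), tree form**: a thermal flux stiffness of
  the `(2m, S^z = 0)` sector (`β ρ_s θ² ≤ log Z_p(0) - log Z_p(θ)` on `|θ| ≤ θ₀`, `2m ≤ L²`) obeys
  `ρ_s L² ≤ τ₂((L² - 2m) + ωL² + c(4τ((L² - 2m) + ω₁L²) + (log N_p)/β)/(U - U₁))`.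
* `ThermalHoleDoublonStiffnessCeilingTT'` / `…_holds` — the `δ`-form node (`δ ≥ 0`, two free `ω`'s).
* `ThermalStrongCouplingStiffnessCeilingTT'` / `…_holds` — **Thm 7_T(xii), closed form** (`8τ < U₁ < U`,
  `ω₁ = 8τ/(U₁ - 8τ)`): `ρ_s ≤ τ₂(n_h + ω + c(4τ n_h + 32τ²/(U₁ - 8τ) + (log N_p)/β/L²)/(U - U₁))`.
* `ThermalStrongCouplingStiffnessCeilingTT'Log4` / `…_holds` — **Thm 7_T(xiii)**: the same with the
  universal entropy budget `(log N_p)/L² ≤ log 4` (`log_card_sector_le`): `… + (log 4)/β …`.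
* `ThermalInfiniteUStiffnessLimsupTT'` / `…_holds` — **Thm 7_T(xiv)**: for every `t'`, `ε > 0` and
  `β₀ > 0` there is `U₀` with `ρ_s ≤ τ₂ n_h + ε` for all `L ≥ 3`, `U ≥ U₀`, `δ ≥ 0`, `β ≥ β₀`:
  **`limsup_{U→∞} ρ_s(T) ≤ (|t| + 2|t'|) n_h` at every fixed temperature**, uniformly in the volume,
  the filling and `T ≤ 1/β₀` — the one-hole (Nagaoka) scale times the HOLE density.

Honest numbers (`t = 1`): the thermal correction to the `T = 0` closed form is
`τ₂ c T (log N_p)/(L²(U - U₁)) ≤ τ₂ c T log 4/(U - U₁)`; at `t' = 0`, `ω = 1/4` (`c = 10`), `U₁ = U/2`: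
`≤ 27.7 T/U`. As at `T = 0` the content is the `U → ∞` statement and its SCALING (`n_h`, not `n`),
not the crossover: the bound is below the `U`-independent one-body ceilings only for `U` of order `10²`.
References (keys of `lean/references.bib`): Nagaoka1966 §II; BrinkmanRice1970; Tasaki1998 §3.2, §6.3;
ScalapinoWhiteZhang1993 §II; ParamekantiTrivediRanderia1998 eq. (3), §IV; HazraVermaRanderia2019 §III,
App. G; XuEtAl2024 eq. (1); Tasaki2020 §2.1, App. A.
-/

noncomputable section

namespace Summit.HubbardSuperconductivity.HubbardLadder.Bounds

open Matrix Finset Real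
open Literature.MathematicalPhysics.QuantumLattice
open Literature.MathematicalPhysics.QuantumFieldTheory
open Literature.Probability.LatticeModels
open Literature.MathematicalPhysics.QuantumLattice.ThermodynamicLimit
open scoped ComplexOrder ComplexConjugate

variable {L : ℕ} [NeZero L]

/-! ### The universal entropy budget -/

omit [NeZero L] in
/-- The universal entropy budget: a coordinate sector has `log N_p ≤ L² log 4` (`N_p ≤ dim 𝓕 = 4^{L²}`). -/
theorem log_card_sector_le (p : Finset (Orb (FermionTorus 2 L)) → Prop) [DecidablePred p]
    [Nonempty {a // p a}] :
    Real.log (Fintype.card {a // p a}) ≤ (L : ℝ) ^ 2 * Real.log 4 := by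
  have hO : Fintype.card (Orb (FermionTorus 2 L)) = L ^ 2 * 2 := by
    simp [Fintype.card_prod, Fintype.card_lex]
  have h1 : Fintype.card {a // p a} ≤ 4 ^ (L ^ 2) := by
    refine (Fintype.card_subtype_le _).trans_eq ?_
    rw [Fintype.card_finset, hO, mul_comm, pow_mul]
    norm_num
  have hpos : (0 : ℝ) < Fintype.card {a // p a} := Nat.cast_pos.2 Fintype.card_pos
  calc Real.log (Fintype.card {a // p a}) ≤ Real.log ((4 : ℝ) ^ (L ^ 2)) :=
        Real.log_le_log hpos (by exact_mod_cast h1)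
    _ = (L : ℝ) ^ 2 * Real.log 4 := by rw [Real.log_pow]; push_cast; ring

/-! ### Thm 7_T(xii): the thermal hole–doublon STIFFNESS ceiling -/

/-- **Thm 7_T(xii), tree form** (`L ≥ 3`, any real `t'`; `ω, ω₁ > 0`, `(1 + |t'|)(8 + 8ω₁⁻¹) ≤ U₁ < U`,
`β, ρ_s, θ₀ > 0`, `2m ≤ L²`, `p` the `(2m, S^z = 0)` coordinate sector, `N_p = dim p`): if the sector free
energy of `hubbardTorusTT'Flux L t' U θ` is stiff in the flux, `β ρ_s θ² ≤ log Z_p(0) - log Z_p(θ)` on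
`|θ| ≤ θ₀`, then `ρ_s L² ≤ (1 + 2|t'|)((L² - 2m) + ωL² + (2 + 2ω⁻¹)(4(1 + |t'|)((L² - 2m) + ω₁L²) +
(log N_p)/β)/(U - U₁))` — the thermal f-sum floor, rotation averaging and the kinetic ceiling. -/
theorem thermalStiffness_mul_sq_le_holeDoublon (hL : 3 ≤ L) (t' : ℝ) {U U₁ ω ω₁ β ρs θ₀ : ℝ}
    (hω : 0 < ω) (hω₁ : 0 < ω₁) (hU₁ : (1 + |t'|) * (8 + 8 * ω₁⁻¹) ≤ U₁) (hU : U₁ < U)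
    (hβ : 0 < β) (hρs : 0 < ρs) (hθ₀ : 0 < θ₀) {m : ℕ} (hmL : 2 * m ≤ L ^ 2)
    (hstiff : ∀ θ : ℝ, |θ| ≤ θ₀ → β * ρs * θ ^ 2 ≤
      Real.log (partitionFn β ((hubbardTorusTT'Flux L t' U 0).toBlock
        (fun s : Finset (Orb (FermionTorus 2 L)) =>
          s.card = 2 * m ∧ 2 * (s.filter fun i => (ofLex i).2 = 0).card = 2 * m)
        (fun s => s.card = 2 * m ∧ 2 * (s.filter fun i => (ofLex i).2 = 0).card = 2 * m))).re -
      Real.log (partitionFn β ((hubbardTorusTT'Flux L t' U θ).toBlock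
        (fun s : Finset (Orb (FermionTorus 2 L)) =>
          s.card = 2 * m ∧ 2 * (s.filter fun i => (ofLex i).2 = 0).card = 2 * m)
        (fun s => s.card = 2 * m ∧ 2 * (s.filter fun i => (ofLex i).2 = 0).card = 2 * m))).re) :
    ρs * (L : ℝ) ^ 2 ≤ (1 + 2 * |t'|) * (((L : ℝ) ^ 2 - (2 * m : ℕ)) + ω * (L : ℝ) ^ 2 +
      (2 + 2 * ω⁻¹) * ((4 * (1 + |t'|) * (((L : ℝ) ^ 2 - (2 * m : ℕ)) + ω₁ * (L : ℝ) ^ 2) +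
        Real.log (Fintype.card {s : Finset (Orb (FermionTorus 2 L)) //
          s.card = 2 * m ∧ 2 * (s.filter fun i => (ofLex i).2 = 0).card = 2 * m}) / β) /
            (U - U₁))) := by
  set p : Finset (Orb (FermionTorus 2 L)) → Prop := fun s =>
    s.card = 2 * m ∧ 2 * (s.filter fun i => (ofLex i).2 = 0).card = 2 * m with hp
  haveI : Nonempty {a // p a} := nonempty_spinZeroSector (L := L) (by omega)
  have hfloor := thermalStiffnessTT'_mul_sq_le_kinetic hL t' U hβ hρs hθ₀ p hstiff
  have hrot := two_mul_re_gibbsState_kinOpTT'_le hL t' U β p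
    (fun s t h => sector_iff_of_fockMapOp_rot_ne_zero _ h)
  have hkin := neg_re_gibbsState_hoppingTwo_le_holeDoublon t' hω hω₁ hU₁ hU hβ hmL p
    (fun s hs => hs.1) (fun s hs => spinZeroSector_of_card_upPart_downPart hs)
  linarith

/-- **Thm 7_T(xii) (thermal hole–doublon stiffness ceiling, `t–t'` class; PROVED below).** `L ≥ 3`,
any real `t'`, `0 ≤ δ`, `ω, ω₁ > 0`, `(1 + |t'|)(8 + 8ω₁⁻¹) ≤ U₁ < U`, `β, ρ_s, θ₀ > 0`,
`N_L = 2⌊(1-δ)L²/2⌋`, `p` the `(N_L, S^z = 0)` coordinate sector, `N_p = dim p`: if the sector free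
energy of `hubbardTorusTT'Flux L t' U θ` (`t–t'` torus, `x`-seam twist) is stiff in the flux,
`β ρ_s θ² ≤ log Z_p(0) - log Z_p(θ)` on `|θ| ≤ θ₀`, then `ρ_s L² ≤ (1 + 2|t'|)((L² - N_L) + ωL² +
(2 + 2ω⁻¹)(4(1 + |t'|)((L² - N_L) + ω₁L²) + (log N_p)/β)/(U - U₁))`. At `T → 0` (`(log N_p)/β → 0`)
it is the landed Thm 7(vii) with the counting brackets `R = 0`, `L₁ = -4τ((L² - N_L) + ω₁L²)`.
kind: support (PROVED). Why it might fail: it cannot; loose when `⟨D⟩_β` is. Sources: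
HazraVermaRanderia2019 §III, App. G; Nagaoka1966 §II; ParamekantiTrivediRanderia1998 eq. (3), §IV;
XuEtAl2024 eq. (1); this cell (Thm 7(vii), Thm 8♯(v)). -/
@[conjecture] def ThermalHoleDoublonStiffnessCeilingTT' : Prop :=
  ∀ (L : ℕ) [NeZero L], 3 ≤ L → ∀ (t' U U₁ δ β ρs θ₀ ω ω₁ : ℝ), 0 ≤ δ → 0 < ω → 0 < ω₁ →
    (1 + |t'|) * (8 + 8 * ω₁⁻¹) ≤ U₁ → U₁ < U → 0 < β → 0 < ρs → 0 < θ₀ →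
    let p : Finset (Orb (FermionTorus 2 L)) → Prop := fun s =>
      s.card = 2 * ⌊(1 - δ) * (L : ℝ) ^ 2 / 2⌋₊ ∧
        2 * (s.filter fun i => (ofLex i).2 = 0).card = 2 * ⌊(1 - δ) * (L : ℝ) ^ 2 / 2⌋₊
    (∀ θ : ℝ, |θ| ≤ θ₀ → β * ρs * θ ^ 2 ≤
        Real.log (partitionFn β ((hubbardTorusTT'Flux L t' U 0).toBlock p p)).re -
          Real.log (partitionFn β ((hubbardTorusTT'Flux L t' U θ).toBlock p p)).re) →
    ρs * (L : ℝ) ^ 2 ≤ (1 + 2 * |t'|) * (((L : ℝ) ^ 2 - (rectN (1 - δ) L : ℕ)) + ω * (L : ℝ) ^ 2 +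
      (2 + 2 * ω⁻¹) * ((4 * (1 + |t'|) * (((L : ℝ) ^ 2 - (rectN (1 - δ) L : ℕ)) + ω₁ * (L : ℝ) ^ 2) +
        Real.log (Fintype.card {s // p s}) / β) / (U - U₁)))

/-- **`ThermalHoleDoublonStiffnessCeilingTT'` holds.** -/
theorem thermalHoleDoublonStiffnessCeilingTT'_holds : ThermalHoleDoublonStiffnessCeilingTT' := by
  intro L _ hL t' U U₁ δ β ρs θ₀ ω ω₁ hδ hω hω₁ hU₁ hU hβ hρs hθ₀
  dsimp only; intro hst
  have h := thermalStiffness_mul_sq_le_holeDoublon hL t' hω hω₁ hU₁ hU hβ hρs hθ₀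
    (two_mul_natFloor_le_sq hδ L) hst
  have hrect : ((rectN (1 - δ) L : ℕ) : ℝ) = ((2 * ⌊(1 - δ) * (L : ℝ) ^ 2 / 2⌋₊ : ℕ) : ℝ) := by
    rw [rectN]
  rw [hrect]
  exact h

/-! ### Thm 7_T(xii)–(xiii): closed forms at or below half filling -/

/-- Arithmetic: divide the finite-volume ceiling by `L² > 0` (the entropy term becomes `ℓ/L²`). -/
private theorem div_sq_formT {ρ S a h ω c p q ℓ W : ℝ} (hS : 0 < S) (hW : W ≠ 0)
    (H : ρ * S ≤ a * (h + ω * S + c * ((p * h + q * S + ℓ) / W))) :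
    ρ ≤ a * (h / S + ω + c * ((p * (h / S) + q + ℓ / S) / W)) := by
  have key : a * (h / S + ω + c * ((p * (h / S) + q + ℓ / S) / W)) * S =
      a * (h + ω * S + c * ((p * h + q * S + ℓ) / W)) := by
    field_simp
  exact le_of_mul_le_mul_right (H.trans_eq key.symm) hS

/-- **Thm 7_T(xii) (thermal strong-coupling stiffness ceiling, `t–t'` class, closed form; PROVED
below).** `L ≥ 3`, any real `t'`, `τ := 1 + |t'|`, `0 ≤ δ`, `8τ < U₁ < U`, `β, ρ_s, θ₀ > 0`, `ω > 0`,
`p` the `(N_L, S^z = 0)` coordinate sector, `N_p = dim p = binom(L², N_L/2)²`: a thermal flux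
stiffness of the sector of `hubbardTorusTT' L 1 t' U` obeys, with `n_h = holeDensity L δ`,
`ρ_s ≤ (1 + 2|t'|)(n_h + ω + (2 + 2ω⁻¹)(4τ n_h + 32τ²/(U₁ - 8τ) + (log N_p)/(βL²))/(U - U₁))`
(part 2's closed form plus ONE entropy term `T (log N_p)/L² ≤ T log 4` inside the `1/(U - U₁)` chord).
kind: support (PROVED). Why it might fail: it cannot. Sources: Nagaoka1966 §II; HazraVermaRanderia2019
§III, App. G; this cell (Thm 7(viii)). -/
@[conjecture] def ThermalStrongCouplingStiffnessCeilingTT' : Prop :=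
  ∀ (L : ℕ) [NeZero L], 3 ≤ L → ∀ (t' U U₁ δ β ρs θ₀ ω : ℝ), 0 ≤ δ → 8 * (1 + |t'|) < U₁ →
    U₁ < U → 0 < β → 0 < ρs → 0 < θ₀ → 0 < ω →
    let p : Finset (Orb (FermionTorus 2 L)) → Prop := fun s =>
      s.card = 2 * ⌊(1 - δ) * (L : ℝ) ^ 2 / 2⌋₊ ∧
        2 * (s.filter fun i => (ofLex i).2 = 0).card = 2 * ⌊(1 - δ) * (L : ℝ) ^ 2 / 2⌋₊
    (∀ θ : ℝ, |θ| ≤ θ₀ → β * ρs * θ ^ 2 ≤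
        Real.log (partitionFn β ((hubbardTorusTT'Flux L t' U 0).toBlock p p)).re -
          Real.log (partitionFn β ((hubbardTorusTT'Flux L t' U θ).toBlock p p)).re) →
    ρs ≤ (1 + 2 * |t'|) * (holeDensity L δ + ω + (2 + 2 * ω⁻¹) *
      ((4 * (1 + |t'|) * holeDensity L δ + 32 * (1 + |t'|) ^ 2 / (U₁ - 8 * (1 + |t'|)) +
        Real.log (Fintype.card {s // p s}) / β / (L : ℝ) ^ 2) / (U - U₁)))

/-- **Proof of `ThermalStrongCouplingStiffnessCeilingTT'`** (`ω₁ = 8τ/(U₁ - 8τ)`, so that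
`(1 + |t'|)(8 + 8ω₁⁻¹) = U₁` and `4τ ω₁ = 32τ²/(U₁ - 8τ)`). -/
theorem thermalStrongCouplingStiffnessCeilingTT'_holds : ThermalStrongCouplingStiffnessCeilingTT' := by
  intro L _ hL t' U U₁ δ β ρs θ₀ ω hδ hU₁8 hU₁ hβ hρs hθ₀ hω
  dsimp only; intro hst
  have hL2 : (0 : ℝ) < (L : ℝ) ^ 2 := by have := NeZero.pos L; positivity
  set τ : ℝ := 1 + |t'| with hτ_def
  have hτ : 0 < τ := by positivity
  set ω₁ : ℝ := 8 * τ / (U₁ - 8 * τ) with hω₁_def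
  have hU₁8' : 0 < U₁ - 8 * τ := sub_pos.2 hU₁8
  have hω₁ : 0 < ω₁ := div_pos (by positivity) hU₁8'
  have hU₁eq : τ * (8 + 8 * ω₁⁻¹) ≤ U₁ := by
    rw [hω₁_def, inv_div]
    have : τ * (8 + 8 * ((U₁ - 8 * τ) / (8 * τ))) = U₁ := by field_simp; ring
    exact this.le
  have h := thermalStiffness_mul_sq_le_holeDoublon hL t' hω hω₁ hU₁eq hU₁ hβ hρs hθ₀
    (two_mul_natFloor_le_sq hδ L) hst
  rw [← hτ_def] at h
  have hrect : ((rectN (1 - δ) L : ℕ) : ℝ) = ((2 * ⌊(1 - δ) * (L : ℝ) ^ 2 / 2⌋₊ : ℕ) : ℝ) := by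
    rw [rectN]
  rw [← hrect] at h
  have h4 : ∀ hh ℓ : ℝ, 4 * τ * (hh + ω₁ * (L : ℝ) ^ 2) + ℓ =
      4 * τ * hh + 32 * τ ^ 2 / (U₁ - 8 * τ) * (L : ℝ) ^ 2 + ℓ := by
    intro hh ℓ; rw [hω₁_def]; field_simp; ring
  rw [h4] at h
  have := div_sq_formT hL2 (sub_pos.2 hU₁).ne' h
  simpa only [holeDensity] using this

/-- **Thm 7_T(xiii) (the universal entropy budget; PROVED below).** As `ThermalStrongCouplingStiffnessCeilingTT'`
with `(log N_p)/L² ≤ log 4`: `ρ_s ≤ (1 + 2|t'|)(n_h + ω + (2 + 2ω⁻¹)(4τ n_h + 32τ²/(U₁ - 8τ) +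
(log 4)/β)/(U - U₁))` — explicit in `t'`, `U`, `U₁`, `ω`, the filling and the temperature `T = 1/β` only.
kind: support (PROVED). Why it might fail: it cannot. Sources: as above. -/
@[conjecture] def ThermalStrongCouplingStiffnessCeilingTT'Log4 : Prop :=
  ∀ (L : ℕ) [NeZero L], 3 ≤ L → ∀ (t' U U₁ δ β ρs θ₀ ω : ℝ), 0 ≤ δ → 8 * (1 + |t'|) < U₁ →
    U₁ < U → 0 < β → 0 < ρs → 0 < θ₀ → 0 < ω →
    let p : Finset (Orb (FermionTorus 2 L)) → Prop := fun s =>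
      s.card = 2 * ⌊(1 - δ) * (L : ℝ) ^ 2 / 2⌋₊ ∧
        2 * (s.filter fun i => (ofLex i).2 = 0).card = 2 * ⌊(1 - δ) * (L : ℝ) ^ 2 / 2⌋₊
    (∀ θ : ℝ, |θ| ≤ θ₀ → β * ρs * θ ^ 2 ≤
        Real.log (partitionFn β ((hubbardTorusTT'Flux L t' U 0).toBlock p p)).re -
          Real.log (partitionFn β ((hubbardTorusTT'Flux L t' U θ).toBlock p p)).re) →
    ρs ≤ (1 + 2 * |t'|) * (holeDensity L δ + ω + (2 + 2 * ω⁻¹) *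
      ((4 * (1 + |t'|) * holeDensity L δ + 32 * (1 + |t'|) ^ 2 / (U₁ - 8 * (1 + |t'|)) +
        Real.log 4 / β) / (U - U₁)))

/-- **Proof of `ThermalStrongCouplingStiffnessCeilingTT'Log4`** (`log_card_sector_le`, monotonicity). -/
theorem thermalStrongCouplingStiffnessCeilingTT'Log4_holds :
    ThermalStrongCouplingStiffnessCeilingTT'Log4 := by
  intro L _ hL t' U U₁ δ β ρs θ₀ ω hδ hU₁8 hU₁ hβ hρs hθ₀ hω
  dsimp only; intro hst
  have h := thermalStrongCouplingStiffnessCeilingTT'_holds L hL t' U U₁ δ β ρs θ₀ ω hδ hU₁8 hU₁ hβ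
    hρs hθ₀ hω hst
  have hL2 : (0 : ℝ) < (L : ℝ) ^ 2 := by have := NeZero.pos L; positivity
  set p : Finset (Orb (FermionTorus 2 L)) → Prop := fun s =>
    s.card = 2 * ⌊(1 - δ) * (L : ℝ) ^ 2 / 2⌋₊ ∧
      2 * (s.filter fun i => (ofLex i).2 = 0).card = 2 * ⌊(1 - δ) * (L : ℝ) ^ 2 / 2⌋₊ with hp
  haveI : Nonempty {a // p a} :=
    nonempty_spinZeroSector (L := L) (NoGo.floor_pairNumber_le δ (by linarith) L)
  have hℓ : Real.log (Fintype.card {a // p a}) / β / (L : ℝ) ^ 2 ≤ Real.log 4 / β := by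
    rw [div_div, div_le_div_iff₀ (by positivity) hβ]
    have := log_card_sector_le p
    nlinarith
  set a : ℝ := 1 + 2 * |t'| with ha_def
  set c : ℝ := 2 + 2 * ω⁻¹ with hc_def
  set P : ℝ := 4 * (1 + |t'|) * holeDensity L δ + 32 * (1 + |t'|) ^ 2 / (U₁ - 8 * (1 + |t'|))
    with hP_def
  have ha : 0 ≤ a := by positivity
  have hc : 0 ≤ c := by positivity
  have hW : 0 < U - U₁ := sub_pos.2 hU₁
  have h1 : (P + Real.log (Fintype.card {a // p a}) / β / (L : ℝ) ^ 2) / (U - U₁) ≤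
      (P + Real.log 4 / β) / (U - U₁) :=
    div_le_div_of_nonneg_right (by linarith) hW.le
  have h2 := mul_le_mul_of_nonneg_left h1 hc
  have h3 : holeDensity L δ + ω + c * ((P + Real.log (Fintype.card {a // p a}) / β / (L : ℝ) ^ 2) /
      (U - U₁)) ≤ holeDensity L δ + ω + c * ((P + Real.log 4 / β) / (U - U₁)) := by linarith
  exact h.trans (mul_le_mul_of_nonneg_left h3 ha)

/-! ### Thm 7_T(xiv): the `U → ∞` asymptotics at fixed temperature -/

/-- **Thm 7_T(xiv) (`limsup_{U→∞} ρ_s(T) ≤ (|t| + 2|t'|) n_h` at every temperature, uniformly in the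
volume, the filling and `T ≤ 1/β₀`; PROVED below).** For every real `t'`, `ε > 0` and `β₀ > 0` there is
`U₀` such that for all `L ≥ 3`, `U ≥ U₀`, `δ ≥ 0`, `β ≥ β₀`, every thermal flux stiffness `ρ_s > 0` of the
`(N_L, S^z = 0)` sector of `hubbardTorusTT' L 1 t' U` satisfies `ρ_s ≤ (1 + 2|t'|) n_h + ε` — the
one-hole (Nagaoka) scale `|t| + 2|t'|` (the maximal `x`-curvature of the band) times the HOLE density.
kind: support (PROVED). Why it might fail: it cannot. Sources: Nagaoka1966 §II; BrinkmanRice1970;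
HazraVermaRanderia2019 §III; this cell (Thm 7(x)). -/
@[conjecture] def ThermalInfiniteUStiffnessLimsupTT' : Prop :=
  ∀ (t' ε β₀ : ℝ), 0 < ε → 0 < β₀ → ∃ U₀ : ℝ, ∀ (L : ℕ) [NeZero L], 3 ≤ L →
    ∀ (U δ β ρs θ₀ : ℝ), U₀ ≤ U → 0 ≤ δ → β₀ ≤ β → 0 < ρs → 0 < θ₀ →
    let p : Finset (Orb (FermionTorus 2 L)) → Prop := fun s =>
      s.card = 2 * ⌊(1 - δ) * (L : ℝ) ^ 2 / 2⌋₊ ∧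
        2 * (s.filter fun i => (ofLex i).2 = 0).card = 2 * ⌊(1 - δ) * (L : ℝ) ^ 2 / 2⌋₊
    (∀ θ : ℝ, |θ| ≤ θ₀ → β * ρs * θ ^ 2 ≤
        Real.log (partitionFn β ((hubbardTorusTT'Flux L t' U 0).toBlock p p)).re -
          Real.log (partitionFn β ((hubbardTorusTT'Flux L t' U θ).toBlock p p)).re) →
      ρs ≤ (1 + 2 * |t'|) * holeDensity L δ + ε

/-- **Proof of `ThermalInfiniteUStiffnessLimsupTT'`**: the `log 4` form with `(1 + 2|t'|)ω = ε/2`,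
`U₁ = 40τ` and `U ≥ 40τ + 1 + 2(1 + 2|t'|)c(5τ + (log 4)/β₀)/ε`, `c = 2 + 2ω⁻¹`, using `0 ≤ n_h ≤ 1`
and `(log 4)/β ≤ (log 4)/β₀`. -/
theorem thermalInfiniteUStiffnessLimsupTT'_holds : ThermalInfiniteUStiffnessLimsupTT' := by
  intro t' ε β₀ hε hβ₀
  set τ : ℝ := 1 + |t'| with hτ_def
  set a : ℝ := 1 + 2 * |t'| with ha_def
  have hτ : 1 ≤ τ := by rw [hτ_def]; linarith [abs_nonneg t']
  have ha : 1 ≤ a := by rw [ha_def]; linarith [abs_nonneg t']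
  set ω : ℝ := ε / (2 * a) with hω_def
  have hω : 0 < ω := by positivity
  set c : ℝ := 2 + 2 * ω⁻¹ with hc_def
  have hc : 0 < c := by positivity
  have hl4 : 0 ≤ Real.log 4 := Real.log_nonneg (by norm_num)
  set M : ℝ := 5 * τ + Real.log 4 / β₀ with hM_def
  have hM : 0 < M := by positivity
  refine ⟨40 * τ + 1 + 2 * a * c * M / ε, fun L _ hL U δ β ρs θ₀ hU hδ hββ hρs hθ₀ => ?_⟩
  dsimp only; intro hst
  have hβ : 0 < β := lt_of_lt_of_le hβ₀ hββ
  have hpos : 0 < 2 * a * c * M / ε := by positivity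
  have hU₁ : 40 * τ < U := by linarith
  have hU₁8 : 8 * (1 + |t'|) < 40 * τ := by rw [hτ_def]; linarith [abs_nonneg t']
  have h := thermalStrongCouplingStiffnessCeilingTT'Log4_holds L hL t' U (40 * τ) δ β ρs θ₀ ω hδ
    hU₁8 hU₁ hβ hρs hθ₀ hω hst
  rw [← hτ_def, ← ha_def, ← hc_def] at h
  obtain ⟨h0, h1, -⟩ := holeDensity_bounds hδ L
  have hW : 0 < U - 40 * τ := by linarith
  have h32 : 32 * τ ^ 2 / (40 * τ - 8 * τ) = τ := by
    field_simp
    ring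
  rw [h32] at h
  have hlog : Real.log 4 / β ≤ Real.log 4 / β₀ := div_le_div_of_nonneg_left hl4 hβ₀ hββ
  have hnum : 4 * τ * holeDensity L δ + τ + Real.log 4 / β ≤ M := by rw [hM_def]; nlinarith
  have hrem : c * ((4 * τ * holeDensity L δ + τ + Real.log 4 / β) / (U - 40 * τ)) ≤
      c * (M / (U - 40 * τ)) :=
    mul_le_mul_of_nonneg_left (div_le_div_of_nonneg_right hnum hW.le) hc.le
  have hfin : a * (c * (M / (U - 40 * τ))) ≤ ε / 2 := by
    rw [← mul_div_assoc, ← mul_div_assoc, div_le_iff₀ hW]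
    have hU' : 2 * a * c * M / ε ≤ U - 40 * τ - 1 := by linarith
    rw [div_le_iff₀ hε] at hU'
    nlinarith
  have haω : a * ω = ε / 2 := by
    rw [hω_def]; field_simp
  have ha0 : 0 ≤ a := by linarith
  have hexp : a * (holeDensity L δ + ω + c * ((4 * τ * holeDensity L δ + τ + Real.log 4 / β) /
      (U - 40 * τ))) ≤ a * holeDensity L δ + ε := by
    have := mul_le_mul_of_nonneg_left hrem ha0
    nlinarith
  exact h.trans hexp

end Summit.HubbardSuperconductivity.HubbardLadder.Bounds

end
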